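import Mathlib
import Literature.NumberTheory.Transcendental.SqrtSevenCertificate
import Literature.NumberTheory.Transcendental.SqrtSevenLValueIdentityProofs
import Literature.NumberTheory.Transcendental.BlochWignerDerivative
import Literature.NumberTheory.Transcendental.BlochWignerFiveTerm
import Literature.NumberTheory.Transcendental.BlochWignerDilogarithmProofs
import Summits.KontsevichZagierPeriods.KontsevichZagierPeriods.Theorems.HyperbolicBlochZagierDilogarithmConjectureStubHeptagonalDehnZero
import HarnessLib

/-!
# `ZagierDilogarithmConjecture` (stmt-KontsevichZagierPeriods-10550) — line
`kummer-clausen-linearisation` (c3), stub `stub_heptagonalVolume`: the heptagonal volume relation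
is EXACT

Let `ζ = e^{2πi/7}`, `η = ζ + ζ² + ζ⁴ = (−1 + √−7)/2` (the Gauss period, `hept_gaussPeriod`),
`x = (1 + √−7)/2 = 1 + η`, `y = (−1 + √−7)/4 = η/2`, and `D = blochWignerDilog` the Bloch–Wigner
dilogarithm. **Theorem (`stub_heptagonalVolume`).**

    7·D(ζ) + 7·D(ζ²) − 7·D(ζ³) − 8·D(x) − 4·D(y) = 0,

i.e. the value relation that lead c2's `stub_heptagonalRelation` takes as its hypothesis `hvol`
(numerically `< 2e-15`; both sides are rational multiples of `√7·ζ_{ℚ(√−7)}(2)/π²`, Zagier 1986).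
With it the heptagonal membership `7[ζ] + 7[ζ²] − 7[ζ³] − 8[x] − 4[y] ∈ ⟨dilogRelators⟩` is
conditional on Dupont's Borel–Suslin fact only.

Proof (no new transcendental input; exact arithmetic in `ℚ(ζ₇) = ℚ[ζ]/(1 + ζ + ⋯ + ζ⁶)`, every
identity checked by `linear_combination _ * hΦ`). Put `u = (−1 + ζ + ζ² + ζ⁴)/2 = (−3 + √−7)/4`
(`|u| = 1`). Four ingredients:
* (0) the tree's `√7` certificate `SqrtSevenCertificate.sqrt7_certificate`
  (39 five-term instances): `6D(u) − 6D(u²) + 2D(u³) = 7(D(ζ) + D(ζ²) + D(ζ⁴))`;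
* (C) `D(ζ⁴) = −D(ζ³)` (`ζ⁴ = (ζ³)⁻¹`; the tree's `SqrtSevenCertificate.iden_49`);
* (A) the five-term instance `V(u, u)` (`blochWignerDilog_five_term`): `(1−u)/(1−u²) = 1 − x`,
  `1 − u·u = 1 − u²`, so `2D(u) − 2D(x) − D(u²) = 0` (`blochWignerDilog_one_sub`);
* (B) the five-term instance `V(u, u²)`: `(1−u)/(1−u³) = 2 + η = 1 − y⁻¹`,
  `(1−u²)/(1−u³) = η = (ȳ)⁻¹`, so `D(u) + D(u²) − D(u³) + 2D(y) = 0` (`blochWignerDilog_one_sub`,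
  `_inv`, `_conj'`).
Then `7(Dζ + Dζ² − Dζ³) = 6Du − 6Du² + 2Du³ = 8Du − 4Du² + 4Dy = 8Dx + 4Dy`.
The identities are first proved for an abstract `ζ : ℂ` with `1 + ζ + ⋯ + ζ⁶ = 0`, `conj ζ = ζ⁶`
(`hept_vol_*`), then specialised to `ζ = exp(2πi/7)` (`SqrtSeven.geom_sum_ζ₇`,
`SqrtSeven.zeta7_conj`) with `x, y` put in `ζ`-coordinates by `hept_gaussPeriod`.
Sorry-free; axioms ⊆ {propext, Classical.choice, Quot.sound}.

References: D. Zagier, Invent. Math. 83 (1986) 285–301, §4 (the `ℚ(√−7)` example);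
Bailey–Borwein–Broadhurst–Zudilin 2010, §5 [BaileyEtAl2010].
-/

noncomputable section

open scoped ComplexConjugate
open Literature.NumberTheory.Transcendental

namespace Summit.KontsevichZagierPeriods.HyperbolicBloch.ZagierDilogarithmCertificate

open Summit.KontsevichZagierPeriods.HyperbolicBloch.ZagierDilogarithmGaloisDescent (hept_gaussPeriod)

/-- `u = (−1 + ζ + ζ² + ζ⁴)/2` is non-zero (explicit inverse in `ℚ(ζ₇)`). [folklore] -/
theorem hept_vol_u_ne_zero (ζ : ℂ) (hΦ : 1 + ζ + ζ ^ 2 + ζ ^ 3 + ζ ^ 4 + ζ ^ 5 + ζ ^ 6 = 0) :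
    (-(1 / 2 : ℂ) + (1 / 2 : ℂ) * ζ + (1 / 2 : ℂ) * ζ ^ 2 + (1 / 2 : ℂ) * ζ ^ 4) ≠ 0 :=
  left_ne_zero_of_mul_eq_one
    (b := (-(1 : ℂ) - (1 / 2 : ℂ) * ζ - (1 / 2 : ℂ) * ζ ^ 2 - (1 / 2 : ℂ) * ζ ^ 4))
    (by linear_combination (-(1 / 2 : ℂ) + (1 / 4 : ℂ) * ζ - (1 / 4 : ℂ) * ζ ^ 2) * hΦ)

/-- `u = (−1 + ζ + ζ² + ζ⁴)/2` is not `1` (explicit inverse of `u − 1` in `ℚ(ζ₇)`). [folklore] -/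
theorem hept_vol_u_ne_one (ζ : ℂ) (hΦ : 1 + ζ + ζ ^ 2 + ζ ^ 3 + ζ ^ 4 + ζ ^ 5 + ζ ^ 6 = 0) :
    (-(1 / 2 : ℂ) + (1 / 2 : ℂ) * ζ + (1 / 2 : ℂ) * ζ ^ 2 + (1 / 2 : ℂ) * ζ ^ 4) ≠ 1 := by
  intro h
  have h2 : ((-(1 / 2 : ℂ) + (1 / 2 : ℂ) * ζ + (1 / 2 : ℂ) * ζ ^ 2 + (1 / 2 : ℂ) * ζ ^ 4) - 1) *
      (-(4 / 7 : ℂ) - (1 / 7 : ℂ) * ζ - (1 / 7 : ℂ) * ζ ^ 2 - (1 / 7 : ℂ) * ζ ^ 4) = 1 := by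
    linear_combination (-(1 / 7 : ℂ) + (1 / 14 : ℂ) * ζ - (1 / 14 : ℂ) * ζ ^ 2) * hΦ
  rw [h, sub_self, zero_mul] at h2
  exact zero_ne_one h2

/-- **(A)** The five-term instance `V(u, u)`, `u = (−1 + ζ + ζ² + ζ⁴)/2`: with `u² = −(1 + 3η)/4`
(`η = ζ + ζ² + ζ⁴`), `(1 − u)/(1 − u·u) = 1 − (1 + η)` and `1 − u·u = 1 − u²`, the relation
`blochWignerDilog_five_term` reads `2D(u) − 2D(1 + η) − D(u²) = 0`. [folklore] -/
theorem hept_vol_A (ζ : ℂ) (hΦ : 1 + ζ + ζ ^ 2 + ζ ^ 3 + ζ ^ 4 + ζ ^ 5 + ζ ^ 6 = 0) :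
    2 * blochWignerDilog (-(1 / 2 : ℂ) + (1 / 2 : ℂ) * ζ + (1 / 2 : ℂ) * ζ ^ 2 + (1 / 2 : ℂ) * ζ ^ 4) -
        2 * blochWignerDilog (1 + (ζ + ζ ^ 2 + ζ ^ 4)) -
        blochWignerDilog
          (-(1 / 4 : ℂ) - (3 / 4 : ℂ) * ζ - (3 / 4 : ℂ) * ζ ^ 2 - (3 / 4 : ℂ) * ζ ^ 4) = 0 := by
  have hx0 := hept_vol_u_ne_zero ζ hΦ
  have hx1 := hept_vol_u_ne_one ζ hΦ
  have hxx : (-(1 / 2 : ℂ) + (1 / 2 : ℂ) * ζ + (1 / 2 : ℂ) * ζ ^ 2 + (1 / 2 : ℂ) * ζ ^ 4) *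
      (-(1 / 2 : ℂ) + (1 / 2 : ℂ) * ζ + (1 / 2 : ℂ) * ζ ^ 2 + (1 / 2 : ℂ) * ζ ^ 4) ≠ 1 := by
    intro h
    have h2 : ((-(1 / 2 : ℂ) + (1 / 2 : ℂ) * ζ + (1 / 2 : ℂ) * ζ ^ 2 + (1 / 2 : ℂ) * ζ ^ 4) *
        (-(1 / 2 : ℂ) + (1 / 2 : ℂ) * ζ + (1 / 2 : ℂ) * ζ ^ 2 + (1 / 2 : ℂ) * ζ ^ 4) - 1) *
        (-(2 / 7 : ℂ) + (3 / 7 : ℂ) * ζ + (3 / 7 : ℂ) * ζ ^ 2 + (3 / 7 : ℂ) * ζ ^ 4) = 1 := by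
      linear_combination (-(11 / 14 : ℂ) + (17 / 28 : ℂ) * ζ - (2 / 7 : ℂ) * ζ ^ 2 +
        (9 / 28 : ℂ) * ζ ^ 4 - (3 / 28 : ℂ) * ζ ^ 5 + (3 / 28 : ℂ) * ζ ^ 6) * hΦ
    rw [h, sub_self, zero_mul] at h2
    exact zero_ne_one h2
  have h := blochWignerDilog_five_term hx0 hx1 hx0 hx1 hxx
  have hc : (1 : ℂ) - (-(1 / 2 : ℂ) + (1 / 2 : ℂ) * ζ + (1 / 2 : ℂ) * ζ ^ 2 + (1 / 2 : ℂ) * ζ ^ 4) *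
      (-(1 / 2 : ℂ) + (1 / 2 : ℂ) * ζ + (1 / 2 : ℂ) * ζ ^ 2 + (1 / 2 : ℂ) * ζ ^ 4) ≠ 0 :=
    sub_ne_zero.2 (Ne.symm hxx)
  have e3 : (1 - (-(1 / 2 : ℂ) + (1 / 2 : ℂ) * ζ + (1 / 2 : ℂ) * ζ ^ 2 + (1 / 2 : ℂ) * ζ ^ 4)) /
      (1 - (-(1 / 2 : ℂ) + (1 / 2 : ℂ) * ζ + (1 / 2 : ℂ) * ζ ^ 2 + (1 / 2 : ℂ) * ζ ^ 4) *
        (-(1 / 2 : ℂ) + (1 / 2 : ℂ) * ζ + (1 / 2 : ℂ) * ζ ^ 2 + (1 / 2 : ℂ) * ζ ^ 4)) =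
      1 - (1 + (ζ + ζ ^ 2 + ζ ^ 4)) := by
    rw [div_eq_iff hc]
    linear_combination ((3 / 2 : ℂ) - (5 / 4 : ℂ) * ζ + (1 / 2 : ℂ) * ζ ^ 2 - (3 / 4 : ℂ) * ζ ^ 4 +
      (1 / 4 : ℂ) * ζ ^ 5 - (1 / 4 : ℂ) * ζ ^ 6) * hΦ
  have e4 : (1 : ℂ) - (-(1 / 2 : ℂ) + (1 / 2 : ℂ) * ζ + (1 / 2 : ℂ) * ζ ^ 2 + (1 / 2 : ℂ) * ζ ^ 4) *
      (-(1 / 2 : ℂ) + (1 / 2 : ℂ) * ζ + (1 / 2 : ℂ) * ζ ^ 2 + (1 / 2 : ℂ) * ζ ^ 4) =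
      1 - (-(1 / 4 : ℂ) - (3 / 4 : ℂ) * ζ - (3 / 4 : ℂ) * ζ ^ 2 - (3 / 4 : ℂ) * ζ ^ 4) := by
    linear_combination (-(1 / 2 : ℂ) + (1 / 4 : ℂ) * ζ - (1 / 4 : ℂ) * ζ ^ 2) * hΦ
  rw [e3, e4, blochWignerDilog_one_sub, blochWignerDilog_one_sub] at h
  linear_combination h

/-- **(B)** The five-term instance `V(u, u²)`, `u = (−1 + ζ + ζ² + ζ⁴)/2`, `η = ζ + ζ² + ζ⁴`,
`y = η/2`: with `u³ = (7 + 5η)/8`, `(1 − u)/(1 − u³) = 2 + η = 1 − y⁻¹` (`y⁻¹ = η̄ = −1 − η`),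
`(1 − u²)/(1 − u³) = η = (ȳ)⁻¹`, the relation `blochWignerDilog_five_term` reads
`D(u) + D(u²) − D(u³) + 2D(y) = 0` (`D(1 − w) = D(w⁻¹) = D(w̄) = −D(w)`). [folklore] -/
theorem hept_vol_B (ζ : ℂ) (hΦ : 1 + ζ + ζ ^ 2 + ζ ^ 3 + ζ ^ 4 + ζ ^ 5 + ζ ^ 6 = 0)
    (hconj : conj ζ = ζ ^ 6) :
    blochWignerDilog (-(1 / 2 : ℂ) + (1 / 2 : ℂ) * ζ + (1 / 2 : ℂ) * ζ ^ 2 + (1 / 2 : ℂ) * ζ ^ 4) +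
        blochWignerDilog (-(1 / 4 : ℂ) - (3 / 4 : ℂ) * ζ - (3 / 4 : ℂ) * ζ ^ 2 - (3 / 4 : ℂ) * ζ ^ 4) -
        blochWignerDilog ((7 / 8 : ℂ) + (5 / 8 : ℂ) * ζ + (5 / 8 : ℂ) * ζ ^ 2 + (5 / 8 : ℂ) * ζ ^ 4) +
        2 * blochWignerDilog ((ζ + ζ ^ 2 + ζ ^ 4) / 2) = 0 := by
  have hx0 := hept_vol_u_ne_zero ζ hΦ
  have hx1 := hept_vol_u_ne_one ζ hΦ
  have hy0 : (-(1 / 4 : ℂ) - (3 / 4 : ℂ) * ζ - (3 / 4 : ℂ) * ζ ^ 2 - (3 / 4 : ℂ) * ζ ^ 4) ≠ 0 :=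
    left_ne_zero_of_mul_eq_one
      (b := ((1 / 2 : ℂ) + (3 / 4 : ℂ) * ζ + (3 / 4 : ℂ) * ζ ^ 2 + (3 / 4 : ℂ) * ζ ^ 4))
      (by linear_combination (-(9 / 8 : ℂ) + (9 / 16 : ℂ) * ζ - (9 / 16 : ℂ) * ζ ^ 2) * hΦ)
  have hy1 : (-(1 / 4 : ℂ) - (3 / 4 : ℂ) * ζ - (3 / 4 : ℂ) * ζ ^ 2 - (3 / 4 : ℂ) * ζ ^ 4) ≠ 1 := by
    intro h
    have h2 : ((-(1 / 4 : ℂ) - (3 / 4 : ℂ) * ζ - (3 / 4 : ℂ) * ζ ^ 2 - (3 / 4 : ℂ) * ζ ^ 4) - 1) *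
        (-(2 / 7 : ℂ) + (3 / 7 : ℂ) * ζ + (3 / 7 : ℂ) * ζ ^ 2 + (3 / 7 : ℂ) * ζ ^ 4) = 1 := by
      linear_combination (-(9 / 14 : ℂ) + (9 / 28 : ℂ) * ζ - (9 / 28 : ℂ) * ζ ^ 2) * hΦ
    rw [h, sub_self, zero_mul] at h2
    exact zero_ne_one h2
  have hxy : (-(1 / 2 : ℂ) + (1 / 2 : ℂ) * ζ + (1 / 2 : ℂ) * ζ ^ 2 + (1 / 2 : ℂ) * ζ ^ 4) *
      (-(1 / 4 : ℂ) - (3 / 4 : ℂ) * ζ - (3 / 4 : ℂ) * ζ ^ 2 - (3 / 4 : ℂ) * ζ ^ 4) ≠ 1 := by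
    intro h
    have h2 : ((-(1 / 2 : ℂ) + (1 / 2 : ℂ) * ζ + (1 / 2 : ℂ) * ζ ^ 2 + (1 / 2 : ℂ) * ζ ^ 4) *
        (-(1 / 4 : ℂ) - (3 / 4 : ℂ) * ζ - (3 / 4 : ℂ) * ζ ^ 2 - (3 / 4 : ℂ) * ζ ^ 4) - 1) *
        (-(6 / 7 : ℂ) - (5 / 7 : ℂ) * ζ - (5 / 7 : ℂ) * ζ ^ 2 - (5 / 7 : ℂ) * ζ ^ 4) = 1 := by
      linear_combination (-(1 / 4 : ℂ) + (37 / 56 : ℂ) * ζ + (1 / 7 : ℂ) * ζ ^ 2 +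
        (45 / 56 : ℂ) * ζ ^ 4 - (15 / 56 : ℂ) * ζ ^ 5 + (15 / 56 : ℂ) * ζ ^ 6) * hΦ
    rw [h, sub_self, zero_mul] at h2
    exact zero_ne_one h2
  -- `y⁻¹ = −1 − η` and `(ȳ)⁻¹ = η`
  have hYinv : ((ζ + ζ ^ 2 + ζ ^ 4) / 2)⁻¹ = -1 - (ζ + ζ ^ 2 + ζ ^ 4) :=
    inv_eq_of_mul_eq_one_right
      (by linear_combination (-(1 : ℂ) + (1 / 2 : ℂ) * ζ - (1 / 2 : ℂ) * ζ ^ 2) * hΦ)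
  have hYconj : conj ((ζ + ζ ^ 2 + ζ ^ 4) / 2) = (-1 - (ζ + ζ ^ 2 + ζ ^ 4)) / 2 := by
    simp only [map_div₀, map_add, map_pow, hconj, map_ofNat]
    linear_combination ((1 / 2 : ℂ) - (1 / 2 : ℂ) * ζ ^ 3 + (1 / 2 : ℂ) * ζ ^ 4 -
      (1 / 2 : ℂ) * ζ ^ 5 + (1 / 2 : ℂ) * ζ ^ 6 - (1 / 2 : ℂ) * ζ ^ 10 + (1 / 2 : ℂ) * ζ ^ 11 -
      (1 / 2 : ℂ) * ζ ^ 17 + (1 / 2 : ℂ) * ζ ^ 18) * hΦ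
  have hYconjinv : (conj ((ζ + ζ ^ 2 + ζ ^ 4) / 2))⁻¹ = (ζ + ζ ^ 2 + ζ ^ 4) := by
    rw [hYconj]
    exact inv_eq_of_mul_eq_one_right
      (by linear_combination (-(1 : ℂ) + (1 / 2 : ℂ) * ζ - (1 / 2 : ℂ) * ζ ^ 2) * hΦ)
  have h := blochWignerDilog_five_term hx0 hx1 hy0 hy1 hxy
  have hc : (1 : ℂ) - (-(1 / 2 : ℂ) + (1 / 2 : ℂ) * ζ + (1 / 2 : ℂ) * ζ ^ 2 + (1 / 2 : ℂ) * ζ ^ 4) *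
      (-(1 / 4 : ℂ) - (3 / 4 : ℂ) * ζ - (3 / 4 : ℂ) * ζ ^ 2 - (3 / 4 : ℂ) * ζ ^ 4) ≠ 0 :=
    sub_ne_zero.2 (Ne.symm hxy)
  have e3 : (1 - (-(1 / 2 : ℂ) + (1 / 2 : ℂ) * ζ + (1 / 2 : ℂ) * ζ ^ 2 + (1 / 2 : ℂ) * ζ ^ 4)) /
      (1 - (-(1 / 2 : ℂ) + (1 / 2 : ℂ) * ζ + (1 / 2 : ℂ) * ζ ^ 2 + (1 / 2 : ℂ) * ζ ^ 4) *
        (-(1 / 4 : ℂ) - (3 / 4 : ℂ) * ζ - (3 / 4 : ℂ) * ζ ^ 2 - (3 / 4 : ℂ) * ζ ^ 4)) =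
      1 - ((ζ + ζ ^ 2 + ζ ^ 4) / 2)⁻¹ := by
    rw [div_eq_iff hc, hYinv]
    linear_combination (-(1 / 4 : ℂ) - (5 / 8 : ℂ) * ζ - (1 / 2 : ℂ) * ζ ^ 2 - (9 / 8 : ℂ) * ζ ^ 4 +
      (3 / 8 : ℂ) * ζ ^ 5 - (3 / 8 : ℂ) * ζ ^ 6) * hΦ
  have e5 : (1 - (-(1 / 4 : ℂ) - (3 / 4 : ℂ) * ζ - (3 / 4 : ℂ) * ζ ^ 2 - (3 / 4 : ℂ) * ζ ^ 4)) /
      (1 - (-(1 / 2 : ℂ) + (1 / 2 : ℂ) * ζ + (1 / 2 : ℂ) * ζ ^ 2 + (1 / 2 : ℂ) * ζ ^ 4) *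
        (-(1 / 4 : ℂ) - (3 / 4 : ℂ) * ζ - (3 / 4 : ℂ) * ζ ^ 2 - (3 / 4 : ℂ) * ζ ^ 4)) =
      (conj ((ζ + ζ ^ 2 + ζ ^ 4) / 2))⁻¹ := by
    rw [div_eq_iff hc, hYconjinv]
    linear_combination ((5 / 4 : ℂ) - (11 / 8 : ℂ) * ζ + (1 / 4 : ℂ) * ζ ^ 2 - (9 / 8 : ℂ) * ζ ^ 4 +
      (3 / 8 : ℂ) * ζ ^ 5 - (3 / 8 : ℂ) * ζ ^ 6) * hΦ
  have e4 : (1 : ℂ) - (-(1 / 2 : ℂ) + (1 / 2 : ℂ) * ζ + (1 / 2 : ℂ) * ζ ^ 2 + (1 / 2 : ℂ) * ζ ^ 4) *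
      (-(1 / 4 : ℂ) - (3 / 4 : ℂ) * ζ - (3 / 4 : ℂ) * ζ ^ 2 - (3 / 4 : ℂ) * ζ ^ 4) =
      1 - ((7 / 8 : ℂ) + (5 / 8 : ℂ) * ζ + (5 / 8 : ℂ) * ζ ^ 2 + (5 / 8 : ℂ) * ζ ^ 4) := by
    linear_combination ((3 / 4 : ℂ) - (3 / 8 : ℂ) * ζ + (3 / 8 : ℂ) * ζ ^ 2) * hΦ
  have d3 : blochWignerDilog (1 - ((ζ + ζ ^ 2 + ζ ^ 4) / 2)⁻¹) =
      blochWignerDilog ((ζ + ζ ^ 2 + ζ ^ 4) / 2) := by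
    rw [blochWignerDilog_one_sub, blochWignerDilog_inv, neg_neg]
  have d4 :
      blochWignerDilog (1 - ((7 / 8 : ℂ) + (5 / 8 : ℂ) * ζ + (5 / 8 : ℂ) * ζ ^ 2 + (5 / 8 : ℂ) * ζ ^ 4)) =
      -blochWignerDilog ((7 / 8 : ℂ) + (5 / 8 : ℂ) * ζ + (5 / 8 : ℂ) * ζ ^ 2 + (5 / 8 : ℂ) * ζ ^ 4) :=
    blochWignerDilog_one_sub _
  have d5 : blochWignerDilog (conj ((ζ + ζ ^ 2 + ζ ^ 4) / 2))⁻¹ =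
      blochWignerDilog ((ζ + ζ ^ 2 + ζ ^ 4) / 2) := by
    rw [blochWignerDilog_inv, blochWignerDilog_conj', neg_neg]
  rw [e3, e5, e4, d3, d4, d5] at h
  linear_combination h

/-- **The heptagonal volume relation in `ζ`-coordinates.** For `ζ : ℂ` with `1 + ζ + ⋯ + ζ⁶ = 0`
and `conj ζ = ζ⁶`, `η = ζ + ζ² + ζ⁴`:
`7D(ζ) + 7D(ζ²) − 7D(ζ³) − 8D(1 + η) − 4D(η/2) = 0` — the linear combination
`−(0) − 7·(C) + 4·(A) − 2·(B)` of the `√7` certificate `sqrt7_certificate`, `iden_49` (C) and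
`hept_vol_A`, `hept_vol_B`.
[cite: BaileyEtAl2010, §5 eq. (clausen)] -/
theorem hept_vol_aux (ζ : ℂ) (hΦ : 1 + ζ + ζ ^ 2 + ζ ^ 3 + ζ ^ 4 + ζ ^ 5 + ζ ^ 6 = 0)
    (hconj : conj ζ = ζ ^ 6) :
    7 * blochWignerDilog ζ + 7 * blochWignerDilog (ζ ^ 2) - 7 * blochWignerDilog (ζ ^ 3) -
        8 * blochWignerDilog (1 + (ζ + ζ ^ 2 + ζ ^ 4)) -
        4 * blochWignerDilog ((ζ + ζ ^ 2 + ζ ^ 4) / 2) = 0 := by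
  have hcert := SqrtSevenCertificate.sqrt7_certificate ζ hΦ hconj
  have hu2 : (-(1 / 2 : ℂ) + (1 / 2 : ℂ) * ζ + (1 / 2 : ℂ) * ζ ^ 2 + (1 / 2 : ℂ) * ζ ^ 4) ^ 2 =
      (-(1 / 4 : ℂ) - (3 / 4 : ℂ) * ζ - (3 / 4 : ℂ) * ζ ^ 2 - (3 / 4 : ℂ) * ζ ^ 4) := by
    linear_combination ((1 / 2 : ℂ) - (1 / 4 : ℂ) * ζ + (1 / 4 : ℂ) * ζ ^ 2) * hΦ
  have hu3 : (-(1 / 2 : ℂ) + (1 / 2 : ℂ) * ζ + (1 / 2 : ℂ) * ζ ^ 2 + (1 / 2 : ℂ) * ζ ^ 4) ^ 3 =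
      ((7 / 8 : ℂ) + (5 / 8 : ℂ) * ζ + (5 / 8 : ℂ) * ζ ^ 2 + (5 / 8 : ℂ) * ζ ^ 4) := by
    linear_combination (-(1 : ℂ) + (3 / 4 : ℂ) * ζ - (3 / 8 : ℂ) * ζ ^ 2 + (3 / 8 : ℂ) * ζ ^ 4 -
      (1 / 8 : ℂ) * ζ ^ 5 + (1 / 8 : ℂ) * ζ ^ 6) * hΦ
  rw [hu2, hu3] at hcert
  have hA := hept_vol_A ζ hΦ
  have hB := hept_vol_B ζ hΦ hconj
  have hC := SqrtSevenCertificate.iden_49 ζ hΦ hconj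
  linear_combination (-1 : ℝ) * hcert - 7 * hC + 4 * hA - 2 * hB

/-- **Registered stub `stub_heptagonalVolume`: the heptagonal volume relation is EXACT.** For
`ζ = e^{2πi/7}`, `x = (1 + √7·i)/2`, `y = (−1 + √7·i)/4` and the Bloch–Wigner dilogarithm `D`:
`7D(ζ) + 7D(ζ²) − 7D(ζ³) − 8D(x) − 4D(y) = 0`. By `hept_vol_aux` at `ζ = exp(2πi/7)`
(`1 + ζ + ⋯ + ζ⁶ = 0`, `conj ζ = ζ⁶`) after `x = 1 + η`, `y = η/2` for the Gauss period
`η = ζ + ζ² + ζ⁴ = (−1 + √7·i)/2` (`hept_gaussPeriod`). The value identity is Zagier's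
`ℚ(√−7)` example (Invent. Math. 83 (1986), §4) / the "√7 identity" of
Bailey–Borwein–Broadhurst–Zudilin; here it is a formal consequence of 41 five-term relations.
[cite: BaileyEtAl2010, §5 eq. (clausen)] -/
theorem stub_heptagonalVolume :
    7 * blochWignerDilog (Complex.exp (2 * Real.pi * Complex.I / 7)) +
          7 * blochWignerDilog (Complex.exp (2 * Real.pi * Complex.I / 7) ^ 2) -
          7 * blochWignerDilog (Complex.exp (2 * Real.pi * Complex.I / 7) ^ 3) -
          8 * blochWignerDilog ((1 + (Real.sqrt 7 : ℂ) * Complex.I) / 2) -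
          4 * blochWignerDilog ((-1 + (Real.sqrt 7 : ℂ) * Complex.I) / 4) = 0 := by
  have hx : (1 + (Real.sqrt 7 : ℂ) * Complex.I) / 2 =
      1 + (Complex.exp (2 * Real.pi * Complex.I / 7) +
        Complex.exp (2 * Real.pi * Complex.I / 7) ^ 2 +
        Complex.exp (2 * Real.pi * Complex.I / 7) ^ 4) := by
    rw [hept_gaussPeriod]; ring
  have hy : (-1 + (Real.sqrt 7 : ℂ) * Complex.I) / 4 =
      (Complex.exp (2 * Real.pi * Complex.I / 7) +
        Complex.exp (2 * Real.pi * Complex.I / 7) ^ 2 +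
        Complex.exp (2 * Real.pi * Complex.I / 7) ^ 4) / 2 := by
    rw [hept_gaussPeriod]; ring
  rw [hx, hy]
  exact hept_vol_aux _ SqrtSeven.geom_sum_ζ₇ SqrtSeven.zeta7_conj

end Summit.KontsevichZagierPeriods.HyperbolicBloch.ZagierDilogarithmCertificate

end
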